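import Literature.Analysis.FluidPDE.TaoForcedUniquenessHolds
import Literature.Analysis.FluidPDE.TaoClassSymmetry
import Literature.Analysis.FluidPDE.AxisymmetricReflection
import HarnessLib

/-!
# Symmetry preservation for FORCED finite-energy classical Navier–Stokes solutions

Analysis/FluidPDE support file (cell `pub/ns-blowup`, seat `ns-blowup-lean` g8). LABEL: E–C
typing / kernel plumbing (theorems only; no definition, no named fact). WHAT THIS IS NOT: not a
statement about Navier–Stokes blow-up — uniqueness bookkeeping: which symmetries the UNIQUE forced
continuation of a symmetric datum under a symmetric force must carry.

The tree proves that decaying classical solutions from axisymmetric data under axisymmetric forces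
stay axisymmetric (`IsClassicalNSSolutionOn.isAxisymmetric_of_data_holds`, uniform rapid decay,
Majda–Bertozzi 2002, §3.1.1 Cor. 3.1) and that UNFORCED Tao-class solutions inherit every isometry
equivariance of their datum (`IsTaoSolutionOn.conj_eq_of_datum`, hence axisymmetry and the absence
of swirl, `IsTaoSolutionOn.isAxisymmetric` / `.hasNoSwirl`). This file records the same folklore
argument (Majda–Bertozzi 2002, §1.2 Prop. 1.1 (iii): rotation symmetry of the equations; §2.3.3,
(2.52)–(2.53): "the solution … will remain axisymmetric"; Lemarié-Rieusset 2016, §10.3,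
(10.20)–(10.21), p. 284: no swirl is preserved) for the FORCED finite-energy class in which the tree's
forced unconditional uniqueness theorems live:

* Tao's general class — `ν > 0`, force jointly smooth on `[0,T] × ℝ³` with
  `‖f‖_{L^∞_t H¹_x} < ∞`, `H¹` datum, finite energy (`tao2011_forced_unconditionalUniqueness_velocity_holds`,
  Tao 2013, Cor. 11.4 WITH force): `IsClassicalNSSolutionOn.conj_eq_of_forced` — if a linear isometry
  `R` of `ℝ³` fixes the datum and the force on the slab (`R u₀ R⁻¹ = u₀`, `R f(t) R⁻¹ = f(t)`), it
  fixes the solution at every `t ∈ [0,T]`; corollaries `isAxisymmetric_of_forced` (all rotations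
  about the axis, `isAxisymmetric_iff_conj_rotZLIE`) and `hasNoSwirl_of_forced` (moreover the meridian
  reflection `reflY`, `IsAxisymmetric.conj_reflY_eq` / `.hasNoSwirl_of_conj_reflY_eq`);
* the Clay class — force smooth on `[0, ∞) × ℝ³` with Fefferman's space-time decay (5), datum with
  `u₀, ∇u₀ ∈ L²` (`tao2011_forced_unconditionalUniqueness_velocity_schwartzForce_holds'`):
  `IsClassicalNSSolutionOn.conj_eq_of_clayForce`, `isAxisymmetric_of_clayForce`,
  `hasNoSwirl_of_clayForce` — the binder shape of the E–C register's stages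
  (`Summits/…/FluidComputer/PalasekTowerEpisodes.lean`, `Stage.classical/initial/energy`).

The conjugate `(t, x) ↦ R (u t (R⁻¹ x))`, `p t (R⁻¹ x)` is a classical solution with force
`R f(t) R⁻¹ = f(t)` (`IsClassicalNSSolutionOn.conj_linearIsometryEquiv`, `.congr_force`), the same
datum and the same energy (`lintegral_enorm_sq_conj_linearIsometryEquiv`: Lebesgue measure and norms
are `R`-invariant), so forced uniqueness identifies it with `u`. No analysis beyond the cited tree
theorems is involved.

## Mathlib / tree search

Tree: `IsClassicalNSSolutionOn.conj_linearIsometryEquiv`, `.congr_force` (`IsometryInvariance`),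
`lintegral_comp_linearIsometryEquiv` (`TaoClassSymmetry`), `tao2011_forced_unconditionalUniqueness_velocity_holds`
(`TaoForcedUniquenessHolds`), `tao2011_forced_unconditionalUniqueness_velocity_schwartzForce_holds'`
(`TaoForcedBoundedTotalSpeed`), `isAxisymmetric_iff_conj_rotZLIE`, `reflY`,
`IsAxisymmetric.conj_reflY_eq`, `IsAxisymmetric.hasNoSwirl_of_conj_reflY_eq` (`AxisymmetricReflection`).
Mathlib: `LinearIsometryEquiv.norm_map`, `uniqueDiffOn_Icc`.

## References

* A. J. Majda, A. L. Bertozzi, *Vorticity and Incompressible Flow*, CUP 2002, §1.2 Prop. 1.1 (iii),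
  §2.3.3 (2.52)–(2.53). [MajdaBertozziCUP2002]
* P. G. Lemarié-Rieusset, *The Navier–Stokes Problem in the 21st Century*, CRC Press 2016, §10.3,
  p. 282 and (10.20)–(10.21), p. 284. [LemarieRieusset2016]
* T. Tao, *Localisation and compactness properties of the Navier–Stokes global regularity problem*,
  Anal. PDE 6 (2013) = arXiv:1108.1165, Cor. 11.4. [Tao2011]
-/

noncomputable section

open MeasureTheory Set Function Filter Topology
open scoped ENNReal NNReal ContDiff

namespace Literature.Analysis.FluidPDE

/-! ### Energy invariance under conjugation by a linear isometry -/

section Energy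

variable {E : Type*} [NormedAddCommGroup E] [InnerProductSpace ℝ E] [FiniteDimensional ℝ E]
  [MeasurableSpace E] [BorelSpace E]

/-- **The energy is invariant under the symmetry group**: `∫⁻ ‖R (w (R⁻¹ x))‖ₑ² dx = ∫⁻ ‖w x‖ₑ² dx`
for a linear isometry `R` (norm and Lebesgue measure are `R`-invariant,
`lintegral_comp_linearIsometryEquiv`; Majda–Bertozzi 2002, §1.2 Prop. 1.1 (iii): the rotated field
`v_Q(x,t) = Qᵗ v(Qx,t)` is again a solution, with the same kinetic energy (1.27)).
[cite: MajdaBertozziCUP2002, §1.2 Prop. 1.1 (iii)] -/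
theorem lintegral_enorm_sq_conj_linearIsometryEquiv (R : E ≃ₗᵢ[ℝ] E) (w : E → E) :
    ∫⁻ x, ‖R (w (R.symm x))‖ₑ ^ 2 = ∫⁻ x, ‖w x‖ₑ ^ 2 := by
  calc ∫⁻ x, ‖R (w (R.symm x))‖ₑ ^ 2 = ∫⁻ x, ‖w (R.symm x)‖ₑ ^ 2 :=
        lintegral_congr fun x => by rw [← ofReal_norm, R.norm_map, ofReal_norm]
    _ = ∫⁻ x, ‖w x‖ₑ ^ 2 := lintegral_comp_linearIsometryEquiv R.symm (fun x => ‖w x‖ₑ ^ 2)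

/-- A uniform energy bound on a time set transfers to the conjugated field `R u(t) R⁻¹` (`ℝ≥0` form,
the binder shape of `tao2011_forced_unconditionalUniqueness_velocity`; Majda–Bertozzi 2002, §1.2
Prop. 1.1 (iii)). [cite: MajdaBertozziCUP2002, §1.2 Prop. 1.1 (iii)] -/
theorem energyBound_conj_linearIsometryEquiv (R : E ≃ₗᵢ[ℝ] E) {S : Set ℝ} {u : ℝ → E → E}
    (huE : ∃ C : ℝ≥0, ∀ t ∈ S, ∫⁻ x, ‖u t x‖ₑ ^ 2 ≤ C) :
    ∃ C : ℝ≥0, ∀ t ∈ S, ∫⁻ x, ‖R (u t (R.symm x))‖ₑ ^ 2 ≤ C := by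
  obtain ⟨C, hC⟩ := huE
  exact ⟨C, fun t ht => (lintegral_enorm_sq_conj_linearIsometryEquiv R (u t)).le.trans (hC t ht)⟩

/-- A uniform energy bound on a time set transfers to the conjugated field `R u(t) R⁻¹` (`ℝ≥0∞` form,
the binder shape of the E–C register's `Stage.energy`; Majda–Bertozzi 2002, §1.2 Prop. 1.1 (iii)).
[cite: MajdaBertozziCUP2002, §1.2 Prop. 1.1 (iii)] -/
theorem energyBound_conj_linearIsometryEquiv' (R : E ≃ₗᵢ[ℝ] E) {S : Set ℝ} {u : ℝ → E → E}
    (huE : ∃ C : ℝ≥0∞, C < ⊤ ∧ ∀ t ∈ S, ∫⁻ x, ‖u t x‖ₑ ^ 2 ≤ C) :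
    ∃ C : ℝ≥0∞, C < ⊤ ∧ ∀ t ∈ S, ∫⁻ x, ‖R (u t (R.symm x))‖ₑ ^ 2 ≤ C := by
  obtain ⟨C, hC, hb⟩ := huE
  exact ⟨C, hC, fun t ht =>
    (lintegral_enorm_sq_conj_linearIsometryEquiv R (u t)).le.trans (hb t ht)⟩

end Energy

/-! ### Tao's general forced class: smooth force with `‖f‖_{L^∞_t H¹_x} < ∞`, `H¹` datum -/

section General

variable {ν T : ℝ} {f u : ℝ → EuclideanSpace ℝ (Fin 3) → EuclideanSpace ℝ (Fin 3)}
  {p : ℝ → EuclideanSpace ℝ (Fin 3) → ℝ}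

/-- **Forced finite-energy classical solutions inherit every isometry symmetry of datum and force
(Tao's general class).** Let `ν > 0`, `0 < T`, `(u, p)` a classical solution of the forced system on
`[0,T] × ℝ³` with finite energy, force `f` jointly smooth on the slab with `‖f‖_{L^∞_t H¹_x} < ∞`, and
`u(0) ∈ H¹`. If a linear isometry `R` of `ℝ³` fixes the datum, `R u(0, R⁻¹x) = u(0, x)`, and the force
on the slab, `R f(t, R⁻¹x) = f(t, x)`, then `R u(t, R⁻¹x) = u(t, x)` for every `t ∈ [0,T]`: the
conjugate is a solution of the same forced system (Majda–Bertozzi 2002, §1.2 Prop. 1.1 (iii),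
`IsClassicalNSSolutionOn.conj_linearIsometryEquiv`) from the same datum with the same energy, and
forced finite-energy classical solutions are unique (Tao 2013, Cor. 11.4 WITH force,
`tao2011_forced_unconditionalUniqueness_velocity_holds`). [cite: MajdaBertozziCUP2002, §1.2 Prop. 1.1 (iii) and §2.3.3 (2.52)–(2.53); Tao2011, Cor. 11.4] -/
theorem IsClassicalNSSolutionOn.conj_eq_of_forced
    (R : EuclideanSpace ℝ (Fin 3) ≃ₗᵢ[ℝ] EuclideanSpace ℝ (Fin 3)) (hν : 0 < ν) (hT : 0 < T)
    (hu : IsClassicalNSSolutionOn (Icc 0 T) ν f u p) (hf : IsSmoothSpaceTimeOn (Icc 0 T) f)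
    (hfH1 : ∀ j ≤ 1, ∃ C : ℝ≥0, ∀ t ∈ Icc 0 T, ∫⁻ x, ‖iteratedFDeriv ℝ j (f t) x‖ₑ ^ 2 ≤ C)
    (h₀ : ∀ j ≤ 1, ∫⁻ x, ‖iteratedFDeriv ℝ j (u 0) x‖ₑ ^ 2 < ⊤)
    (huE : ∃ C : ℝ≥0, ∀ t ∈ Icc 0 T, ∫⁻ x, ‖u t x‖ₑ ^ 2 ≤ C)
    (hfR : ∀ t ∈ Icc 0 T, ∀ x, R (f t (R.symm x)) = f t x)
    (h0R : ∀ x, R (u 0 (R.symm x)) = u 0 x) :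
    ∀ t ∈ Icc 0 T, ∀ x, R (u t (R.symm x)) = u t x := by
  have hS : UniqueDiffOn ℝ (Icc 0 T) := uniqueDiffOn_Icc hT
  -- the conjugate solves the same forced system
  have hv : IsClassicalNSSolutionOn (Icc 0 T) ν f (fun s y => R (u s (R.symm y)))
      (fun s y => p s (R.symm y)) :=
    (hu.conj_linearIsometryEquiv R hS).congr_force hfR
  -- same datum and energy
  have hv0 : (fun s y => R (u s (R.symm y))) 0 = u 0 := funext h0R
  have hvE : ∃ C : ℝ≥0, ∀ t ∈ Icc 0 T, ∫⁻ x, ‖(fun s y => R (u s (R.symm y))) t x‖ₑ ^ 2 ≤ C :=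
    energyBound_conj_linearIsometryEquiv R huE
  -- forced unconditional uniqueness
  intro t ht x
  exact congrFun (tao2011_forced_unconditionalUniqueness_velocity_holds hν hT hf hfH1 hu hv h₀ hv0
    huE hvE t ht) x

/-- **Axisymmetry is preserved (forced, Tao's general class).** Under the hypotheses of
`conj_eq_of_forced` on `ν`, `T`, `f`, `u(0)` and the energy: if `u(0)` is axisymmetric and `f(t)` is
axisymmetric for `t ∈ [0,T]`, then `u(t)` is axisymmetric for every `t ∈ [0,T]` (apply
`conj_eq_of_forced` to every rotation `R_θ` about the axis, `isAxisymmetric_iff_conj_rotZLIE`;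
Majda–Bertozzi 2002, §2.3.3, (2.52)–(2.53): "the solution … will remain axisymmetric").
[cite: MajdaBertozziCUP2002, §2.3.3 (2.52)–(2.53); Tao2011, Cor. 11.4] -/
theorem IsClassicalNSSolutionOn.isAxisymmetric_of_forced (hν : 0 < ν) (hT : 0 < T)
    (hu : IsClassicalNSSolutionOn (Icc 0 T) ν f u p) (hf : IsSmoothSpaceTimeOn (Icc 0 T) f)
    (hfH1 : ∀ j ≤ 1, ∃ C : ℝ≥0, ∀ t ∈ Icc 0 T, ∫⁻ x, ‖iteratedFDeriv ℝ j (f t) x‖ₑ ^ 2 ≤ C)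
    (h₀ : ∀ j ≤ 1, ∫⁻ x, ‖iteratedFDeriv ℝ j (u 0) x‖ₑ ^ 2 < ⊤)
    (huE : ∃ C : ℝ≥0, ∀ t ∈ Icc 0 T, ∫⁻ x, ‖u t x‖ₑ ^ 2 ≤ C)
    (hfA : ∀ t ∈ Icc 0 T, IsAxisymmetric (f t)) (h0A : IsAxisymmetric (u 0)) :
    ∀ t ∈ Icc 0 T, IsAxisymmetric (u t) := by
  intro t ht
  rw [isAxisymmetric_iff_conj_rotZLIE]
  intro θ x
  exact hu.conj_eq_of_forced (rotZLIE θ) hν hT hf hfH1 h₀ huE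
    (fun s hs y => (isAxisymmetric_iff_conj_rotZLIE (f s)).1 (hfA s hs) θ y)
    ((isAxisymmetric_iff_conj_rotZLIE (u 0)).1 h0A θ) t ht x

/-- **No swirl is preserved (forced, Tao's general class).** Under the hypotheses of
`conj_eq_of_forced`: if `u(0)` is axisymmetric without swirl and `f(t)` is axisymmetric without swirl
for `t ∈ [0,T]`, then `u(t)` has no swirl for every `t ∈ [0,T]` (the datum and force are fixed by the
meridian reflection `σ = reflY`, `IsAxisymmetric.conj_reflY_eq`; this propagates by
`conj_eq_of_forced`; an axisymmetric `σ`-fixed field has no swirl,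
`IsAxisymmetric.hasNoSwirl_of_conj_reflY_eq`; Lemarié-Rieusset 2016, (10.20)–(10.21): "the solution
`u` will still have no swirl"). [cite: LemarieRieusset2016, §10.3 (10.20)–(10.21), p. 284; MajdaBertozziCUP2002, §2.3.3 (2.52)–(2.53)] -/
theorem IsClassicalNSSolutionOn.hasNoSwirl_of_forced (hν : 0 < ν) (hT : 0 < T)
    (hu : IsClassicalNSSolutionOn (Icc 0 T) ν f u p) (hf : IsSmoothSpaceTimeOn (Icc 0 T) f)
    (hfH1 : ∀ j ≤ 1, ∃ C : ℝ≥0, ∀ t ∈ Icc 0 T, ∫⁻ x, ‖iteratedFDeriv ℝ j (f t) x‖ₑ ^ 2 ≤ C)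
    (h₀ : ∀ j ≤ 1, ∫⁻ x, ‖iteratedFDeriv ℝ j (u 0) x‖ₑ ^ 2 < ⊤)
    (huE : ∃ C : ℝ≥0, ∀ t ∈ Icc 0 T, ∫⁻ x, ‖u t x‖ₑ ^ 2 ≤ C)
    (hfA : ∀ t ∈ Icc 0 T, IsAxisymmetric (f t)) (hfS : ∀ t ∈ Icc 0 T, HasNoSwirl (f t))
    (h0A : IsAxisymmetric (u 0)) (h0S : HasNoSwirl (u 0)) :
    ∀ t ∈ Icc 0 T, HasNoSwirl (u t) := by
  intro t ht
  exact (hu.isAxisymmetric_of_forced hν hT hf hfH1 h₀ huE hfA h0A t ht).hasNoSwirl_of_conj_reflY_eq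
    (hu.conj_eq_of_forced reflY hν hT hf hfH1 h₀ huE
      (fun s hs y => (hfA s hs).conj_reflY_eq (hfS s hs) y) (h0A.conj_reflY_eq h0S) t ht)

end General

/-! ### The Clay class: force smooth on `[0, ∞) × ℝ³` with Fefferman's decay, `u₀, ∇u₀ ∈ L²` -/

section Clay

variable {ν T : ℝ} {u₀ : EuclideanSpace ℝ (Fin 3) → EuclideanSpace ℝ (Fin 3)}
  {f u : ℝ → EuclideanSpace ℝ (Fin 3) → EuclideanSpace ℝ (Fin 3)}
  {p : ℝ → EuclideanSpace ℝ (Fin 3) → ℝ}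

/-- **Forced finite-energy classical solutions inherit every isometry symmetry of datum and force
(Clay-class force).** Let `ν > 0`, `0 < T`, `u₀` with `u₀, ∇u₀ ∈ L²`, `f` smooth on `[0, ∞) × ℝ³`
with Fefferman's space-time decay (5), and `(u, p)` a classical solution of the forced system on
`[0,T] × ℝ³` from `u₀` with finite energy `sup_{[0,T]} ∫|u|² < ∞` — the binder shape of a registered
stage of the E–C register. If a linear isometry `R` of `ℝ³` fixes `u₀` and fixes `f(t)` for
`t ∈ [0,T]`, then `R u(t, R⁻¹x) = u(t, x)` on `[0,T]` (conjugation covariance + Tao 2013, Cor. 11.4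
WITH a Clay-class force, `tao2011_forced_unconditionalUniqueness_velocity_schwartzForce_holds'`).
[cite: MajdaBertozziCUP2002, §1.2 Prop. 1.1 (iii) and §2.3.3 (2.52)–(2.53); Tao2011, Cor. 11.4] -/
theorem IsClassicalNSSolutionOn.conj_eq_of_clayForce
    (R : EuclideanSpace ℝ (Fin 3) ≃ₗᵢ[ℝ] EuclideanSpace ℝ (Fin 3)) (hν : 0 < ν) (hT : 0 < T)
    (h₀ : MemLp u₀ 2 volume) (h₁ : MemLp (fderiv ℝ u₀) 2 volume)
    (hfs : IsSmoothOnHalfSpace f) (hfd : HasRapidSpaceTimeDecay f)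
    (hu : IsClassicalNSSolutionOn (Icc 0 T) ν f u p) (hu0 : u 0 = u₀)
    (huE : ∃ C : ℝ≥0∞, C < ⊤ ∧ ∀ t ∈ Icc 0 T, ∫⁻ x, ‖u t x‖ₑ ^ 2 ≤ C)
    (hfR : ∀ t ∈ Icc 0 T, ∀ x, R (f t (R.symm x)) = f t x)
    (h0R : ∀ x, R (u₀ (R.symm x)) = u₀ x) :
    ∀ t ∈ Icc 0 T, ∀ x, R (u t (R.symm x)) = u t x := by
  have hS : UniqueDiffOn ℝ (Icc 0 T) := uniqueDiffOn_Icc hT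
  -- the conjugate solves the same forced system
  have hv : IsClassicalNSSolutionOn (Icc 0 T) ν f (fun s y => R (u s (R.symm y)))
      (fun s y => p s (R.symm y)) :=
    (hu.conj_linearIsometryEquiv R hS).congr_force hfR
  -- same datum and energy
  have hv0 : (fun s y => R (u s (R.symm y))) 0 = u₀ := by
    funext y
    show R (u 0 (R.symm y)) = u₀ y
    rw [hu0]
    exact h0R y
  have hvE : ∃ C : ℝ≥0∞, C < ⊤ ∧
      ∀ t ∈ Icc 0 T, ∫⁻ x, ‖(fun s y => R (u s (R.symm y))) t x‖ₑ ^ 2 ≤ C :=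
    energyBound_conj_linearIsometryEquiv' R huE
  -- forced unconditional uniqueness, Clay class
  intro t ht x
  exact (congrFun (tao2011_forced_unconditionalUniqueness_velocity_schwartzForce_holds' hν hT h₀ h₁
    hfs hfd hu hv hu0 hv0 huE hvE t ht) x).symm

/-- **Axisymmetry is preserved (Clay-class force).** Under the hypotheses of `conj_eq_of_clayForce`:
if `u₀` is axisymmetric and `f(t)` is axisymmetric for `t ∈ [0,T]`, then `u(t)` is axisymmetric for
every `t ∈ [0,T]` (all rotations about the axis, `isAxisymmetric_iff_conj_rotZLIE`; Majda–Bertozzi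
2002, §2.3.3, (2.52)–(2.53)). [cite: MajdaBertozziCUP2002, §2.3.3 (2.52)–(2.53); Tao2011, Cor. 11.4] -/
theorem IsClassicalNSSolutionOn.isAxisymmetric_of_clayForce (hν : 0 < ν) (hT : 0 < T)
    (h₀ : MemLp u₀ 2 volume) (h₁ : MemLp (fderiv ℝ u₀) 2 volume)
    (hfs : IsSmoothOnHalfSpace f) (hfd : HasRapidSpaceTimeDecay f)
    (hu : IsClassicalNSSolutionOn (Icc 0 T) ν f u p) (hu0 : u 0 = u₀)
    (huE : ∃ C : ℝ≥0∞, C < ⊤ ∧ ∀ t ∈ Icc 0 T, ∫⁻ x, ‖u t x‖ₑ ^ 2 ≤ C)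
    (hfA : ∀ t ∈ Icc 0 T, IsAxisymmetric (f t)) (h0A : IsAxisymmetric u₀) :
    ∀ t ∈ Icc 0 T, IsAxisymmetric (u t) := by
  intro t ht
  rw [isAxisymmetric_iff_conj_rotZLIE]
  intro θ x
  exact hu.conj_eq_of_clayForce (rotZLIE θ) hν hT h₀ h₁ hfs hfd hu0 huE
    (fun s hs y => (isAxisymmetric_iff_conj_rotZLIE (f s)).1 (hfA s hs) θ y)
    ((isAxisymmetric_iff_conj_rotZLIE u₀).1 h0A θ) t ht x

/-- **No swirl is preserved (Clay-class force).** Under the hypotheses of `conj_eq_of_clayForce`: if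
`u₀` is axisymmetric without swirl and `f(t)` is axisymmetric without swirl for `t ∈ [0,T]`, then
`u(t)` has no swirl for every `t ∈ [0,T]` (meridian reflection `reflY`; Lemarié-Rieusset 2016,
(10.20)–(10.21); Majda–Bertozzi 2002, §2.3.3). Together with `isAxisymmetric_of_clayForce`: the class
«axisymmetric without swirl» is hereditary along the unique forced continuation.
[cite: LemarieRieusset2016, §10.3 (10.20)–(10.21), p. 284; MajdaBertozziCUP2002, §2.3.3 (2.52)–(2.53)] -/
theorem IsClassicalNSSolutionOn.hasNoSwirl_of_clayForce (hν : 0 < ν) (hT : 0 < T)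
    (h₀ : MemLp u₀ 2 volume) (h₁ : MemLp (fderiv ℝ u₀) 2 volume)
    (hfs : IsSmoothOnHalfSpace f) (hfd : HasRapidSpaceTimeDecay f)
    (hu : IsClassicalNSSolutionOn (Icc 0 T) ν f u p) (hu0 : u 0 = u₀)
    (huE : ∃ C : ℝ≥0∞, C < ⊤ ∧ ∀ t ∈ Icc 0 T, ∫⁻ x, ‖u t x‖ₑ ^ 2 ≤ C)
    (hfA : ∀ t ∈ Icc 0 T, IsAxisymmetric (f t)) (hfS : ∀ t ∈ Icc 0 T, HasNoSwirl (f t))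
    (h0A : IsAxisymmetric u₀) (h0S : HasNoSwirl u₀) :
    ∀ t ∈ Icc 0 T, HasNoSwirl (u t) := by
  intro t ht
  exact (hu.isAxisymmetric_of_clayForce hν hT h₀ h₁ hfs hfd hu0 huE hfA h0A t
    ht).hasNoSwirl_of_conj_reflY_eq
    (hu.conj_eq_of_clayForce reflY hν hT h₀ h₁ hfs hfd hu0 huE
      (fun s hs y => (hfA s hs).conj_reflY_eq (hfS s hs) y) (h0A.conj_reflY_eq h0S) t ht)

end Clay

end Literature.Analysis.FluidPDE

end
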